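import Mathlib
import Literature.NumberTheory.Irrationality.Fischler2002.Theoreme21Proofs
import HarnessLib

/-!
# Fischler 2002, Corollaire 2.2 (second clause): Vasilyev's integrals in Sorokin's form — PROVED for every `n ≥ 2`

Topic `Literature/NumberTheory/Irrationality/Fischler2002`; proofs-only companion of `BeukersSorokinChangeOfVariables.lean`, whose
NAMED FACT `corollaire22_vasilyev` is DISCHARGED here as `corollaire22_vasilyev_holds`. Cell `pub-zeta5`, seat ct-1 g30, 2026-08-27.
Source: S. Fischler, « Formes linéaires en polyzêtas et intégrales multiples », C. R. Acad. Sci. Paris Sér. I **335** (2002) 1–4 =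
arXiv:math/0202064 [Fischler2002Polyzetas], §2 Corollaire 2.2: "l'intégrale (1) est égale à
`∫_{[0,1]^n} ∏ X_k^N(1−X_k)^N / ∏_{k ∈ {2,…,n} pair} (1 − X₁…X_k)^{N+1} dX` si `n` est pair,
`∫_{[0,1]^n} ∏ X_k^N(1−X_k)^N / ((1 − X₁…X_n)^{N+1} ∏_{k ∈ {2,…,n} pair} (1 − X₁…X_k)^{N+1}) dX` si `n` est impair"
(journal version [Fischler2003RhinViola], §5).

HONEST FRAMING (cells pub-zeta5 / zeta5-irr): systematic search; no irrationality claim unless certified. An identity between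
`n`-fold integrals of non-negative functions; not an irrationality statement; nothing about `ζ(5)`.

## The proof
The same change of variables as Théorème 2.1 (`KL.lintegral_cube_rev`, `KL.lintegral_cube_eq_lintegral_moebius`), applied
directly to Vasilyev's integrand: with `x = Y(X) ∘ rev`, `δ_n(x) = δ̃_n(x)` (`deltaV_eq_altSum`: Vasilyev's `δ_k` is Fischler's
alternating sum) `= ∏_{i≤n}(1−Π_i)^{ε_i}` (`KL.deltaTilde_subst`), the numerator is `∏ X_j^N(1−X_j)^N` times
`∏_{j even}(1−Π_{j−1})^N(1−Π_j)^{−2N}` (`KL.numerator_subst`), and the Jacobian is `∏_{j even}(1−Π_{j−1})(1−Π_j)^{−2}`; the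
exponent of `1 − Π_i` totals `0` for odd `i < n` and `−(N+1)` for `i` even or `i = n` (`vasilyev_exponent`). No parity products,
no counting. Theorems only; no definition; no new named fact (net debt −1).
-/

noncomputable section

namespace Literature.NumberTheory.Irrationality.Fischler2002

open MeasureTheory Set Finset
open scoped ENNReal

namespace KL

open JnChi JnPsi

/-! ### Vasilyev's `δ_k` is the alternating sum of the top products -/

/-- `δ_k(x) = Σ_{j=0}^{k} (−1)^j x_k x_{k−1} ⋯ x_{k−j+1}` (so `δ_n = δ̃_n`). [cite: Fischler2002Polyzetas, §2 p. 2 (δ̃_n(x) = δ_n(x))] -/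
theorem deltaV_eq_altSum {n : ℕ} (x : Fin n → ℝ) :
    ∀ k : ℕ, deltaV x k = ∑ j ∈ Finset.range (k + 1), (-1 : ℝ) ^ j * ∏ i ∈ Finset.range j, coord x (k - i)
  | 0 => by simp [deltaV]
  | k + 1 => by
      rw [deltaV, deltaV_eq_altSum x k, Finset.sum_range_succ' _ (k + 1)]
      simp only [pow_zero, Finset.prod_range_zero, mul_one]
      have h : ∀ j ∈ Finset.range (k + 1), (-1 : ℝ) ^ (j + 1) * ∏ i ∈ Finset.range (j + 1), coord x (k + 1 - i) =
          -(coord x (k + 1) * ((-1 : ℝ) ^ j * ∏ i ∈ Finset.range j, coord x (k - i))) := by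
        intro j _
        rw [Finset.prod_range_succ', Nat.sub_zero, pow_succ]
        simp only [show ∀ i : ℕ, k + 1 - (i + 1) = k - i from fun i => by omega]
        ring
      rw [Finset.sum_congr rfl h, Finset.sum_neg_distrib, ← Finset.mul_sum]
      ring

/-- `δ_n = δ̃_n`. [cite: Fischler2002Polyzetas, §2 p. 2 (δ̃_n(x) = δ_n(x))] -/
theorem deltaV_eq_deltaTilde {n : ℕ} (x : Fin n → ℝ) : deltaV x n = deltaTilde x n := by
  rw [deltaV_eq_altSum]
  rfl

/-! ### The exponents of `1 − X₁⋯X_i` for Vasilyev's integrand -/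

/-- **Exponent bookkeeping for Corollaire 2.2**: the numerator contributes `[i+1 even, ≤ n]N − [i even]2N`, the Jacobian
`[i+1 even, ≤ n] − 2[i even]`, and `δ_n^{−(N+1)}` contributes `−ε_i(N+1)`; the total is `−(N+1)` if `i` is even or `i = n`, else `0`.
[cite: Fischler2002Polyzetas, §2 Corollaire 2.2] -/
theorem vasilyev_exponent {n : ℕ} (N : ℕ) {i : ℕ} (hi : i ∈ Finset.Icc 1 n) :
    (((if Even (i + 1) ∧ i + 1 ≤ n then (N : ℤ) else 0) - (if Even i then (N : ℤ) + N else 0)) +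
        ((if i + 1 ≤ n then (if Even (i + 1) then (1 : ℤ) else 0) else 0) + -(if Even i then (1 : ℤ) + 1 else 0)) +
        -((if Even i then (-1 : ℤ) else 1) * ((N : ℤ) + 1)) : ℤ) =
      -(if Even i ∨ i = n then ((N : ℤ) + 1) else 0) := by
  rw [Finset.mem_Icc] at hi
  by_cases hie : Even i
  · have hio : ¬ Even (i + 1) := Nat.not_even_iff_odd.mpr (Even.add_one hie)
    simp only [hie, hio, false_and, if_false, if_true, true_or]
    split_ifs <;> ring
  · have hio : Even (i + 1) := Odd.add_one (Nat.not_even_iff_odd.mp hie)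
    simp only [hie, hio, true_and, if_true, if_false, false_or]
    by_cases hin : i = n
    · simp only [hin, show ¬ (n + 1 ≤ n) from by omega, if_false, if_true]
      ring
    · simp only [show (i + 1 ≤ n) from by omega, if_true, hin, if_false]
      ring

/-! ### The pointwise identity -/

/-- **Vasilyev's integrand at the substituted point times the Jacobian is the Sorokin-type integrand** (`n ≥ 2`, open cube).
[cite: Fischler2002Polyzetas, §2 Corollaire 2.2] -/
theorem vasilyev_subst {n : ℕ} (hn : 2 ≤ n) (N : ℕ) {X : Fin n → ℝ} (hX : ∀ i, 0 < X i ∧ X i < 1) :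
    (∏ k ∈ Finset.Icc 1 n, coord (fun t : Fin n => (fun i : Fin n => if Even (i.1 + 1) then
          (1 - headProduct X i.1) * X i / (1 - headProduct X (i.1 + 1)) else X i) (Fin.rev t)) k ^ N *
        (1 - coord (fun t : Fin n => (fun i : Fin n => if Even (i.1 + 1) then
          (1 - headProduct X i.1) * X i / (1 - headProduct X (i.1 + 1)) else X i) (Fin.rev t)) k) ^ N) /
        deltaV (fun t : Fin n => (fun i : Fin n => if Even (i.1 + 1) then
          (1 - headProduct X i.1) * X i / (1 - headProduct X (i.1 + 1)) else X i) (Fin.rev t)) n ^ (N + 1) *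
      (∏ j ∈ Finset.Icc 1 n, if Even j then (1 - headProduct X (j - 1)) / (1 - headProduct X j) ^ 2 else (1:ℝ)) =
      (∏ k ∈ Finset.Icc 1 n, coord X k ^ N * (1 - coord X k) ^ N) /
        ∏ k ∈ (Finset.Icc 2 n).filter (fun k => Even k ∨ k = n), (1 - headProduct X k) ^ (N + 1) := by
  set Y : Fin n → ℝ := fun i : Fin n => if Even (i.1 + 1) then
      (1 - headProduct X i.1) * X i / (1 - headProduct X (i.1 + 1)) else X i with hY
  set x : Fin n → ℝ := fun t => Y (Fin.rev t) with hx
  have hne : ∀ j, 1 ≤ j → 1 - headProduct X j ≠ 0 := one_sub_headProduct_ne_zero hX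
  have hy : ∀ j, 1 ≤ j → j ≤ n →
      coord Y j = (if Even j then (1 - headProduct X (j - 1)) / (1 - headProduct X j) else 1) * coord X j :=
    fun j _ _ => by rw [hY]; exact coord_moebiusMap X j
  have hcx : ∀ k, coord x k = coord Y (n + 1 - k) := fun k => coord_rev Y k
  -- (1) numerator
  have hNum : (∏ k ∈ Finset.Icc 1 n, coord x k ^ N * (1 - coord x k) ^ N) =
      (∏ j ∈ Finset.Icc 1 n, coord X j ^ N * (1 - coord X j) ^ N) *
        ∏ i ∈ Finset.Icc 1 n, (1 - headProduct X i) ^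
          ((if Even (i + 1) ∧ i + 1 ≤ n then (N : ℤ) else 0) - (if Even i then (N : ℤ) + N else 0)) := by
    have h1 : (∏ k ∈ Finset.Icc 1 n, coord x k ^ N * (1 - coord x k) ^ N) =
        ∏ j ∈ Finset.Icc 1 n, coord Y j ^ (N : ℤ) * (1 - coord Y j) ^ (N : ℤ) := by
      refine prod_Icc_reflect fun k hk => ?_
      rw [hcx k, zpow_natCast, zpow_natCast]
    have h3 : (∏ j ∈ Finset.Icc 1 n, coord X j ^ N * (1 - coord X j) ^ N) =
        ∏ j ∈ Finset.Icc 1 n, coord X j ^ (N : ℤ) * (1 - coord X j) ^ (N : ℤ) :=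
      Finset.prod_congr rfl fun j _ => by rw [zpow_natCast, zpow_natCast]
    rw [h1, h3]
    have h2 := numerator_subst (coord X) (coord Y) (headProduct X) (fun _ => (N : ℤ)) (fun _ => (N : ℤ))
      (n := n) (by omega) (headProduct_succ X) hne hy
    beta_reduce at h2
    exact h2
  -- (2) `δ_n`
  have hDel : deltaV x n = ∏ i ∈ Finset.Icc 1 n, (1 - headProduct X i) ^ (if Even i then (-1 : ℤ) else 1) := by
    rw [deltaV_eq_deltaTilde]
    exact deltaTilde_subst hX hy le_rfl
  -- (3) the Jacobian weight in exponent form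
  have hW : (∏ j ∈ Finset.Icc 1 n, if Even j then (1 - headProduct X (j - 1)) / (1 - headProduct X j) ^ 2 else (1:ℝ)) =
      ∏ i ∈ Finset.Icc 1 n, (1 - headProduct X i) ^
        ((if i + 1 ≤ n then (if Even (i + 1) then (1 : ℤ) else 0) else 0) + -(if Even i then (1 : ℤ) + 1 else 0)) := by
    have hpt : ∀ j ∈ Finset.Icc 1 n, (if Even j then (1 - headProduct X (j - 1)) / (1 - headProduct X j) ^ 2 else (1:ℝ)) =
        (1 - headProduct X (j - 1)) ^ (if Even j then (1 : ℤ) else 0) * (1 - headProduct X j) ^ (-(if Even j then (1 : ℤ) + 1 else 0)) := by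
      intro j hj
      by_cases hje : Even j
      · simp only [if_pos hje, zpow_one, zpow_neg]
        rw [show ((1 : ℤ) + 1) = ((2 : ℕ) : ℤ) by norm_num, zpow_natCast, div_eq_mul_inv]
      · simp only [if_neg hje, zpow_zero, neg_zero, mul_one]
    rw [Finset.prod_congr rfl hpt, Finset.prod_mul_distrib,
      prod_shift_pred (headProduct X) (fun j => if Even j then (1 : ℤ) else 0) (by omega) (by simp), ← Finset.prod_mul_distrib]
    exact Finset.prod_congr rfl fun i hi => by rw [← zpow_add₀ (hne i (Finset.mem_Icc.1 hi).1)]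
  -- (4) the Sorokin-type denominator in exponent form
  have hDenVS : (∏ k ∈ (Finset.Icc 2 n).filter (fun k => Even k ∨ k = n), (1 - headProduct X k) ^ (N + 1)) =
      ∏ i ∈ Finset.Icc 1 n, (1 - headProduct X i) ^ (if Even i ∨ i = n then ((N : ℤ) + 1) else 0) := by
    rw [Finset.prod_filter]
    have hs : (Finset.Icc 1 n : Finset ℕ) = insert 1 (Finset.Icc 2 n) := by
      ext k; simp only [Finset.mem_insert, Finset.mem_Icc]; omega
    rw [hs, Finset.prod_insert (by simp), if_neg (by rintro (h | h); exacts [Nat.not_even_one h, by omega]), zpow_zero, one_mul]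
    refine Finset.prod_congr rfl fun k _ => ?_
    by_cases h : Even k ∨ k = n
    · rw [if_pos h, if_pos h, show ((N : ℤ) + 1) = ((N + 1 : ℕ) : ℤ) by push_cast; ring, zpow_natCast]
    · rw [if_neg h, if_neg h, zpow_zero]
  -- assemble
  have hPne : (∏ i ∈ Finset.Icc 1 n, (1 - headProduct X i) ^ (if Even i then (-1 : ℤ) else 1)) ≠ 0 :=
    Finset.prod_ne_zero_iff.mpr fun i hi => zpow_ne_zero _ (hne i (Finset.mem_Icc.1 hi).1)
  rw [hNum, hDel, hW, hDenVS, ← zpow_natCast, show ((N + 1 : ℕ) : ℤ) = (N : ℤ) + 1 by push_cast; ring,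
    div_eq_mul_inv, div_eq_mul_inv, ← zpow_neg, ← Finset.prod_zpow, ← Finset.prod_inv_distrib, mul_assoc, mul_assoc,
    ← Finset.prod_mul_distrib, ← Finset.prod_mul_distrib]
  congr 1
  refine Finset.prod_congr rfl fun i hi => ?_
  have hni := hne i (Finset.mem_Icc.1 hi).1
  rw [← zpow_mul, ← zpow_neg, ← zpow_add₀ hni, ← zpow_add₀ hni]
  congr 1
  linear_combination vasilyev_exponent N hi

end KL

open KL JnChi JnPsi in
/-- **Fischler's Corollaire 2.2 (second clause) holds** (the named fact `corollaire22_vasilyev` of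
`BeukersSorokinChangeOfVariables.lean` is a theorem): for every `n ≥ 2` and `N`, Vasilyev's integral
`∫_{[0,1]^n} ∏ x_k^N(1−x_k)^N/δ_n^{N+1}` equals its Sorokin-type form with denominators `(1 − X₁⋯X_k)^{N+1}` over the even
`k ∈ {2,…,n}` together with `k = n`, in `ℝ₊ ∪ {∞}`. Same change of variables as Théorème 2.1, applied directly (no parity products,
no counting). [cite: Fischler2002Polyzetas, §2 Corollaire 2.2] [cite: Fischler2003RhinViola, §5] -/
theorem corollaire22_vasilyev_holds : corollaire22_vasilyev := by
  intro n N hn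
  unfold vasilyevIntegral vasilyevSorokinForm
  rw [← setLIntegral_congr (openCube_ae_eq_unitCube n), ← setLIntegral_congr (openCube_ae_eq_unitCube n),
    lintegral_cube_rev n (fun x => ENNReal.ofReal
      ((∏ k ∈ Finset.Icc 1 n, coord x k ^ N * (1 - coord x k) ^ N) / deltaV x n ^ (N + 1)))]
  have hmeas : Measurable fun y : Fin n → ℝ => ENNReal.ofReal
      ((∏ k ∈ Finset.Icc 1 n, coord (fun i => y (Fin.rev i)) k ^ N * (1 - coord (fun i => y (Fin.rev i)) k) ^ N) /
        deltaV (fun i => y (Fin.rev i)) n ^ (N + 1)) := by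
    have hrev : Measurable fun y : Fin n → ℝ => fun i => y (Fin.rev i) := measurable_pi_lambda _ fun i => measurable_pi_apply _
    have hF : Measurable fun x : Fin n → ℝ =>
        (∏ k ∈ Finset.Icc 1 n, coord x k ^ N * (1 - coord x k) ^ N) / deltaV x n ^ (N + 1) :=
      (Finset.measurable_prod _ fun k _ =>
        ((measurable_coord k).pow_const _).mul ((measurable_const.sub (measurable_coord k)).pow_const _)).div
        ((measurable_deltaV n).pow_const _)
    exact (hF.comp hrev).ennreal_ofReal
  rw [lintegral_cube_eq_lintegral_moebius n _ hmeas]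
  refine setLIntegral_congr_fun (measurableSet_openCube n) fun X hX' => ?_
  have hX : ∀ i, 0 < X i ∧ X i < 1 := fun i => hX' i (Set.mem_univ _)
  dsimp only
  rw [← ENNReal.ofReal_mul' (weight_pos hX).le, vasilyev_subst hn N hX]

end Literature.NumberTheory.Irrationality.Fischler2002

end
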